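import Mathlib.RingTheory.MvPolynomial.Ideal
import Mathlib.RingTheory.Ideal.Maps
import Mathlib.Algebra.MvPolynomial.Equiv
import Mathlib.Algebra.Polynomial.Taylor
import Mathlib.Algebra.Polynomial.Roots
import Mathlib.FieldTheory.Finite.Basic
import HarnessLib

/-!
# Cafure–Matera Lemma 2.2, proof part B: translates and the Schwartz–Zippel lemma with multiplicity

Support file for the proof of `Literature.NumberTheory.DiophantineGeometry.CafureMatera2006_lemma22`
(`CafureMatera.lean`; assembled in `CafureMateraLemma22Proofs.lean`). Everything here is proved.

* Translates `p(X + a) = aeval (fun i ↦ X i + C (a i)) p` (no new definition is introduced):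
  evaluation, composition, injectivity, and `p ∈ 𝔪_a^k ⇒ p(X + a) ∈ (X_1,…,X_n)^k`
  (`shift_mem_pow_idealOfVars`; membership in `MvPolynomial.idealOfVars ^ k` means "all monomials
  have degree `≥ k`", `MvPolynomial.mem_pow_idealOfVars_iff`), i.e. vanishing order `≥ k` at `a`.
* `multiplicity_schwartz_zippel`: Dvir–Kopparty–Saraf–Sudan, *Extensions to the method of
  multiplicities*, SIAM J. Comput. 42 (2013), Lemma 2.7, over `S = 𝔽_q`, in the weighted form
  `(∀ a, ord_a p ≥ N a) → ∑_a N a ≤ deg p · q^{n-1}`.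
-/

namespace Literature.NumberTheory.DiophantineGeometry.CafureMateraLemma22

open MvPolynomial

open scoped Polynomial

section Shift

variable {K : Type*} [CommRing K] {σ τ : Type*}

/-- Substituting polynomials of total degree `≤ 1` does not increase the total degree.
[folklore] -/
theorem totalDegree_aeval_le_of_le_one (g : σ → MvPolynomial τ K)
    (hg : ∀ i, (g i).totalDegree ≤ 1) (p : MvPolynomial σ K) :
    (aeval g p).totalDegree ≤ p.totalDegree := by
  classical
  conv_lhs => rw [p.as_sum]
  rw [map_sum]
  refine totalDegree_finsetSum_le fun s hs => ?_
  rw [aeval_monomial, Finsupp.prod]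
  calc (algebraMap K (MvPolynomial τ K) (coeff s p) * ∏ i ∈ s.support, g i ^ s i).totalDegree
      ≤ (algebraMap K (MvPolynomial τ K) (coeff s p)).totalDegree +
          (∏ i ∈ s.support, g i ^ s i).totalDegree := totalDegree_mul _ _
    _ ≤ 0 + ∑ i ∈ s.support, s i := by
        gcongr
        · rw [MvPolynomial.algebraMap_eq, totalDegree_C]
        · refine (totalDegree_finsetProd _ _).trans (Finset.sum_le_sum fun i _ => ?_)
          calc (g i ^ s i).totalDegree ≤ s i * (g i).totalDegree := totalDegree_pow _ _
            _ ≤ s i * 1 := Nat.mul_le_mul_left _ (hg i)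
            _ = s i := mul_one _
    _ = s.sum fun _ e => e := by rw [zero_add]; rfl
    _ ≤ p.totalDegree := le_totalDegree hs

/-- Evaluating after substituting polynomials for the variables. [folklore] -/
theorem eval_aeval_apply (g : σ → MvPolynomial τ K) (x : τ → K) (p : MvPolynomial σ K) :
    eval x (aeval g p) = eval (fun i => eval x (g i)) p := by
  induction p using MvPolynomial.induction_on with
  | C c => simp
  | add p q hp hq => simp only [map_add, hp, hq]
  | mul_X p i hp => simp only [map_mul, hp, aeval_X, eval_X]

/-- Evaluating a translate: `(p(X + a))(x) = p(x + a)`. [folklore] -/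
theorem eval_shift (a x : σ → K) (p : MvPolynomial σ K) :
    eval x (aeval (fun i => X i + C (a i)) p) = eval (x + a) p := by
  induction p using MvPolynomial.induction_on with
  | C c => simp
  | add p q hp hq => simp only [map_add, hp, hq]
  | mul_X p i hp => simp only [map_mul, hp, aeval_X, map_add, eval_X, eval_C, Pi.add_apply]

/-- Translating twice. [folklore] -/
theorem shift_shift (a b : σ → K) (p : MvPolynomial σ K) :
    aeval (fun i => X i + C (a i)) (aeval (fun i => X i + C (b i)) p) =
      aeval (fun i => X i + C (b i + a i)) p := by
  have h : (fun i => aeval (fun i => X i + C (a i)) (X i + C (b i))) =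
      fun i => (X i + C (b i + a i) : MvPolynomial σ K) := by
    funext i
    simp only [map_add, aeval_X, aeval_C, MvPolynomial.algebraMap_eq]
    ring
  rw [comp_aeval_apply, h]

/-- Translating by `-a` undoes translating by `a`. [folklore] -/
theorem shift_neg_shift (a : σ → K) (p : MvPolynomial σ K) :
    aeval (fun i => X i + C ((-a) i)) (aeval (fun i => X i + C (a i)) p) = p := by
  rw [shift_shift]
  have h : (fun i => X i + C (a i + (-a) i)) = (X : σ → MvPolynomial σ K) := by
    funext i
    simp
  rw [h, aeval_X_left_apply]

/-- Translation is injective. [folklore] -/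
theorem shift_injective (a : σ → K) :
    Function.Injective (aeval (fun i => X i + C (a i)) : MvPolynomial σ K → MvPolynomial σ K) :=
  Function.LeftInverse.injective (shift_neg_shift a)

/-- Translates of nonzero polynomials are nonzero. [folklore] -/
theorem shift_ne_zero {a : σ → K} {p : MvPolynomial σ K} (hp : p ≠ 0) :
    aeval (fun i => X i + C (a i)) p ≠ 0 := fun h =>
  hp (shift_injective a (by rw [h, map_zero]))

/-- If `p` lies in the `k`-th power of the maximal ideal of the point `a`, then its translate
`p(X + a)` lies in the `k`-th power of the ideal of the origin (all its monomials have degree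
`≥ k`). [folklore] -/
theorem shift_mem_pow_idealOfVars (a : σ → K) (k : ℕ) {p : MvPolynomial σ K}
    (h : p ∈ RingHom.ker (eval a) ^ k) :
    aeval (fun i => X i + C (a i)) p ∈ idealOfVars σ K ^ k := by
  have hle : Ideal.map (aeval (fun i => X i + C (a i)) : MvPolynomial σ K →ₐ[K] MvPolynomial σ K)
      (RingHom.ker (eval a)) ≤ idealOfVars σ K := by
    rw [Ideal.map_le_iff_le_comap]
    intro r hr
    rw [RingHom.mem_ker] at hr
    rw [Ideal.mem_comap, ← pow_one (idealOfVars σ K), mem_pow_idealOfVars_iff']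
    intro x hx
    have hx0 : x = 0 := by
      rw [Nat.lt_one_iff, Finsupp.degree_eq_zero_iff] at hx
      exact hx
    subst hx0
    rw [← constantCoeff_eq, ← eval_zero, eval_shift, zero_add, hr]
  have hmem := Ideal.mem_map_of_mem
    (aeval (fun i => X i + C (a i)) : MvPolynomial σ K →ₐ[K] MvPolynomial σ K) h
  rw [Ideal.map_pow] at hmem
  exact Ideal.pow_right_mono hle k hmem

/-- Membership in a power of the ideal of the origin means all monomials have degree `≥ k`;
cf. `MvPolynomial.mem_pow_idealOfVars_iff`. [folklore] -/
theorem le_degree_of_mem_pow_idealOfVars {k : ℕ} {p : MvPolynomial σ K}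
    (h : p ∈ idealOfVars σ K ^ k) {s : σ →₀ ℕ} (hs : s ∈ p.support) : k ≤ s.degree :=
  (mem_pow_idealOfVars_iff k p).1 h s hs

end Shift

section MultSZ

variable {K : Type*} [Field K]

/-- Translating by `(s, a)` in `K[X_0, X_1, …, X_n]` and then singling out `X_0`: the
coefficients (polynomials in `X_1, …, X_n`) are translated by `a`, and the resulting univariate
polynomial is Taylor-shifted by `s`. [folklore] -/
theorem finSuccEquiv_shift_cons {n : ℕ} (s : K) (a : Fin n → K)
    (p : MvPolynomial (Fin (n + 1)) K) :
    finSuccEquiv K n (aeval (fun i => X i + C ((Fin.cons s a : Fin (n + 1) → K) i)) p) =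
      Polynomial.taylor (C s) (Polynomial.map (aeval (fun i => X i + C (a i)) :
        MvPolynomial (Fin n) K →ₐ[K] MvPolynomial (Fin n) K).toRingHom (finSuccEquiv K n p)) := by
  let g : Fin (n + 1) → MvPolynomial (Fin (n + 1)) K := fun i => X i + C ((Fin.cons s a : Fin (n + 1) → K) i)
  let φ : MvPolynomial (Fin n) K →ₐ[K] MvPolynomial (Fin n) K := aeval (fun i => X i + C (a i))
  let L : MvPolynomial (Fin (n + 1)) K →ₐ[K] Polynomial (MvPolynomial (Fin n) K) :=
    (finSuccEquiv K n).toAlgHom.comp (aeval g)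
  let R : MvPolynomial (Fin (n + 1)) K →ₐ[K] Polynomial (MvPolynomial (Fin n) K) :=
    ((Polynomial.taylorAlgHom (C s : MvPolynomial (Fin n) K)).restrictScalars K).comp
      ((Polynomial.mapAlgHom φ).comp (finSuccEquiv K n).toAlgHom)
  have hC : ∀ c : K, finSuccEquiv K n (C c) = Polynomial.C (C c) := fun c => by
    simp [finSuccEquiv_apply]
  have hLR : L = R := by
    refine MvPolynomial.algHom_ext fun i => ?_
    refine Fin.cases ?_ (fun j => ?_) i
    · simp [L, R, g, φ, finSuccEquiv_X_zero, hC, Polynomial.coe_mapAlgHom]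
    · simp [L, R, g, φ, finSuccEquiv_X_succ, hC, Polynomial.coe_mapAlgHom]
  have := congrArg (fun ψ => ψ p) hLR
  simpa [L, R, Polynomial.coe_mapAlgHom] using this

/-- The degree of `Finsupp.cons j α` is `j + deg α`. [folklore] -/
theorem degree_cons {n : ℕ} (j : ℕ) (α : Fin n →₀ ℕ) :
    (Finsupp.cons j α).degree = j + α.degree := by
  rw [Finsupp.degree_eq_sum, Finsupp.degree_eq_sum, Fin.sum_univ_succ]
  simp [Finsupp.cons_zero, Finsupp.cons_succ]

/-- Coefficient formula for a Taylor shift, with a prescribed summation range. [folklore] -/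
theorem coeff_taylor_eq_sum {A : Type*} [CommRing A] (Q : A[X]) (r : A) (j : ℕ) {B : ℕ}
    (hB : Q.natDegree < B) :
    (Polynomial.taylor r Q).coeff j =
      ∑ i ∈ Finset.range B, ((i + j).choose j : A) * Q.coeff (i + j) * r ^ i := by
  rw [Polynomial.taylor_coeff, Polynomial.eval_eq_sum_range'
    (lt_of_le_of_lt ((Polynomial.natDegree_hasseDeriv_le _ _).trans (Nat.sub_le _ _)) hB)]
  refine Finset.sum_congr rfl fun i _ => ?_
  rw [Polynomial.hasseDeriv_coeff]

/-- Extracting the coefficient of the monomial `α` commutes with Taylor shifts by constants.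
[folklore] -/
theorem coeff_coeff_taylor_C {n : ℕ} (Q : Polynomial (MvPolynomial (Fin n) K)) (c : K)
    (α : Fin n →₀ ℕ) (j : ℕ) :
    MvPolynomial.coeff α ((Polynomial.taylor (C c) Q).coeff j) =
      (Polynomial.taylor c (∑ i ∈ Finset.range (Q.natDegree + 1),
        Polynomial.monomial i (MvPolynomial.coeff α (Q.coeff i)))).coeff j := by
  set B := Q.natDegree + 1 with hB
  set u : K[X] := ∑ i ∈ Finset.range B, Polynomial.monomial i (MvPolynomial.coeff α (Q.coeff i))
    with hu
  have hucoeff : ∀ m, u.coeff m = MvPolynomial.coeff α (Q.coeff m) := by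
    intro m
    rw [hu, Polynomial.finsetSum_coeff]
    simp only [Polynomial.coeff_monomial]
    rw [Finset.sum_ite_eq' (Finset.range B) m]
    split_ifs with hm
    · rfl
    · rw [Finset.mem_range, not_lt] at hm
      rw [Polynomial.coeff_eq_zero_of_natDegree_lt (lt_of_lt_of_le (Nat.lt_succ_self _) hm),
        MvPolynomial.coeff_zero]
  have hudeg : u.natDegree < B := by
    rw [hu]
    refine lt_of_le_of_lt (Polynomial.natDegree_sum_le_of_forall_le _ _ (n := Q.natDegree) ?_)
      (Nat.lt_succ_self _)
    intro i hi
    exact (Polynomial.natDegree_monomial_le _).trans (Nat.lt_succ_iff.1 (Finset.mem_range.1 hi))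
  rw [coeff_taylor_eq_sum Q (C c) j (Nat.lt_succ_self _), coeff_taylor_eq_sum u c j hudeg,
    MvPolynomial.coeff_sum]
  refine Finset.sum_congr rfl fun i _ => ?_
  rw [hucoeff, ← C_pow, mul_comm _ (C (c ^ i)), ← map_natCast (C : K →+* MvPolynomial (Fin n) K),
    ← mul_assoc, ← map_mul, MvPolynomial.coeff_C_mul]
  ring

variable [Fintype K] [DecidableEq K]

/-- Sum over `𝔽_q` of the root multiplicities of a nonzero univariate polynomial is at most its
degree. [folklore] -/
theorem sum_rootMultiplicity_le (u : K[X]) :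
    ∑ s, u.rootMultiplicity s ≤ u.natDegree := by
  classical
  calc ∑ s, u.rootMultiplicity s = ∑ s, u.roots.count s := by simp [Polynomial.count_roots]
    _ = ∑ s ∈ u.roots.toFinset, u.roots.count s := by
        refine (Finset.sum_subset (Finset.subset_univ _) fun s _ hs => ?_).symm
        exact Multiset.count_eq_zero.2 fun h => hs (Multiset.mem_toFinset.2 h)
    _ = Multiset.card u.roots := Multiset.toFinset_sum_count_eq _
    _ ≤ u.natDegree := Polynomial.card_roots' u

/-- **Schwartz–Zippel with multiplicities** (Dvir–Kopparty–Saraf–Sudan 2013, Lemma 2.7: "Let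
`P ∈ 𝔽[X]` be an `n`-variate nonzero polynomial of total degree at most `d`. Then for any finite
`S ⊆ 𝔽`, `∑_{a ∈ Sⁿ} mult(P, a) ≤ d · |S|^{n-1}`", here with `S = 𝔽 = 𝔽_q` and in weighted form):
if a nonzero `p ∈ 𝔽_q[X_1,…,X_n]` vanishes to order at least `N(a)` at every `a ∈ 𝔽_qⁿ` (i.e.
`p(X + a)` has no monomial of degree `< N(a)`), then `∑_a N(a) ≤ deg p · q^{n-1}`. Proof as printed
(induction on `n` via the leading coefficient in one variable), phrased with translates and Taylor
shifts instead of Hasse derivatives. [cite: DvirEtAl2013, Lemma 2.7] -/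
theorem multiplicity_schwartz_zippel :
    ∀ {n : ℕ} {p : MvPolynomial (Fin n) K} (_ : p ≠ 0) (N : (Fin n → K) → ℕ)
      (_ : ∀ a, aeval (fun i => X i + C (a i)) p ∈ idealOfVars (Fin n) K ^ N a),
      ∑ a, N a ≤ p.totalDegree * Fintype.card K ^ (n - 1)
  | 0, p, hp, N, hN => by
    have h0 : ∀ a, N a = 0 := by
      intro a
      have ha : (fun i => X i + C (a i)) = (X : Fin 0 → MvPolynomial (Fin 0) K) :=
        funext fun i => Fin.elim0 i
      have := hN a
      rw [ha, aeval_X_left_apply, p.eq_C_of_isEmpty, C_mem_pow_idealOfVars_iff] at this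
      rcases this with h | h
      · exact absurd (by rw [p.eq_C_of_isEmpty, h, map_zero]) hp
      · exact h
    simp [h0]
  | n + 1, p, hp, N, hN => by
    -- Notation: `q = #K`, `P = p` as a polynomial in `X_0`, `r` its degree, `Pr` its leading coeff
    let q := Fintype.card K
    let P : Polynomial (MvPolynomial (Fin n) K) := finSuccEquiv K n p
    let r := P.natDegree
    let Pr := P.leadingCoeff
    have hP0 : P ≠ 0 := (EmbeddingLike.map_ne_zero_iff).2 hp
    have hPr0 : Pr ≠ 0 := by simpa [Pr] using hP0
    -- shifted leading coefficients and their orders of vanishing `k a`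
    let S : (Fin n → K) → MvPolynomial (Fin n) K := fun a => aeval (fun i => X i + C (a i)) Pr
    have hS0 : ∀ a, S a ≠ 0 := fun a => shift_ne_zero hPr0
    have hSne : ∀ a, ((S a).support.image Finsupp.degree).Nonempty := fun a => by
      simpa using hS0 a
    let k : (Fin n → K) → ℕ := fun a => ((S a).support.image Finsupp.degree).min' (hSne a)
    have hk1 : ∀ a, S a ∈ idealOfVars (Fin n) K ^ k a := by
      intro a
      rw [mem_pow_idealOfVars_iff]
      intro x hx
      exact Finset.min'_le _ _ (Finset.mem_image_of_mem _ hx)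
    have hk2 : ∀ a, ∃ α ∈ (S a).support, α.degree = k a := by
      intro a
      obtain ⟨α, hα, h⟩ := Finset.mem_image.1 (Finset.min'_mem _ (hSne a))
      exact ⟨α, hα, h⟩
    -- induction hypothesis for the leading coefficient
    have IH : ∑ a, k a ≤ Pr.totalDegree * q ^ (n - 1) := multiplicity_schwartz_zippel hPr0 k hk1
    -- the key claim, line by line
    have claim : ∀ a : Fin n → K, ∑ s : K, N (Fin.cons s a) ≤ q * k a + r := by
      intro a
      let φ : MvPolynomial (Fin n) K →ₐ[K] MvPolynomial (Fin n) K :=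
        aeval (fun i => X i + C (a i))
      let P₁ : Polynomial (MvPolynomial (Fin n) K) := Polynomial.map φ.toRingHom P
      have hφinj : Function.Injective φ.toRingHom := shift_injective a
      have hP₁deg : P₁.natDegree = r := Polynomial.natDegree_map_eq_of_injective hφinj _
      have hP₁r : P₁.coeff r = S a := by
        rw [Polynomial.coeff_map, Polynomial.coeff_natDegree]
        rfl
      obtain ⟨α, hα, hαk⟩ := hk2 a
      let u : K[X] := ∑ i ∈ Finset.range (P₁.natDegree + 1),
        Polynomial.monomial i (MvPolynomial.coeff α (P₁.coeff i))
      have hucoeff : u.coeff r = MvPolynomial.coeff α (S a) := by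
        simp only [u, Polynomial.finsetSum_coeff, Polynomial.coeff_monomial]
        rw [Finset.sum_ite_eq' _ r, if_pos (by rw [Finset.mem_range, hP₁deg]; exact Nat.lt_succ_self _),
          hP₁r]
      have hu0 : u ≠ 0 := by
        intro h
        rw [h, Polynomial.coeff_zero] at hucoeff
        exact (mem_support_iff.1 hα) hucoeff.symm
      have hudeg : u.natDegree ≤ r := by
        refine Polynomial.natDegree_sum_le_of_forall_le _ _ fun i hi => ?_
        refine (Polynomial.natDegree_monomial_le _).trans ?_
        rw [← hP₁deg]
        exact Nat.lt_succ_iff.1 (Finset.mem_range.1 hi)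
      -- pointwise bound
      have hpt : ∀ s : K, N (Fin.cons s a) ≤ k a + u.rootMultiplicity s := by
        intro s
        let T := aeval (fun i => X i + C ((Fin.cons s a : Fin (n + 1) → K) i)) p
        have hTP : finSuccEquiv K n T = Polynomial.taylor (C s) P₁ :=
          finSuccEquiv_shift_cons s a p
        let j₀ := u.rootMultiplicity s
        have hj₀' : j₀ = (Polynomial.taylor s u).natTrailingDegree := by
          simp only [j₀, Polynomial.rootMultiplicity_eq_natTrailingDegree, Polynomial.taylor_apply]
        have hcoef : (Polynomial.taylor s u).coeff j₀ ≠ 0 := by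
          rw [hj₀']
          exact mt Polynomial.trailingCoeff_eq_zero.1
            ((not_congr (Polynomial.taylor_eq_zero (r := s) (f := u))).2 hu0)
        have hcoef2 : MvPolynomial.coeff α ((finSuccEquiv K n T).coeff j₀) ≠ 0 := by
          rw [hTP, coeff_coeff_taylor_C]
          exact hcoef
        have hsupp : Finsupp.cons j₀ α ∈ T.support := by
          rw [mem_support_iff, ← finSuccEquiv_coeff_coeff]
          exact hcoef2
        have := le_degree_of_mem_pow_idealOfVars (hN (Fin.cons s a)) hsupp
        rw [degree_cons, hαk] at this
        omega
      calc ∑ s : K, N (Fin.cons s a) ≤ ∑ s : K, (k a + u.rootMultiplicity s) :=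
            Finset.sum_le_sum fun s _ => hpt s
        _ = q * k a + ∑ s : K, u.rootMultiplicity s := by
            rw [Finset.sum_add_distrib, Finset.sum_const, Finset.card_univ, smul_eq_mul]
        _ ≤ q * k a + r := by
            have := (sum_rootMultiplicity_le u).trans hudeg
            omega
    -- summing the claim over `a`
    have hsum : ∑ x : Fin (n + 1) → K, N x = ∑ a : Fin n → K, ∑ s : K, N (Fin.cons s a) := by
      rw [← Fintype.sum_equiv (Fin.consEquiv fun _ => K) (fun st => N (Fin.cons st.1 st.2)) N
        (fun st => rfl), Fintype.sum_prod_type, Finset.sum_comm]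
    rw [hsum]
    have hdeg : Pr.totalDegree + r ≤ p.totalDegree :=
      totalDegree_coeff_finSuccEquiv_add_le p r hPr0
    have hcard : Fintype.card (Fin n → K) = q ^ n := by simp [q]
    calc ∑ a : Fin n → K, ∑ s : K, N (Fin.cons s a) ≤ ∑ a : Fin n → K, (q * k a + r) :=
          Finset.sum_le_sum fun a _ => claim a
      _ = q * ∑ a : Fin n → K, k a + q ^ n * r := by
          rw [Finset.sum_add_distrib, Finset.mul_sum, Finset.sum_const, Finset.card_univ, hcard,
            smul_eq_mul]
      _ ≤ q * (Pr.totalDegree * q ^ (n - 1)) + q ^ n * r := by gcongr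
      _ ≤ p.totalDegree * q ^ (n + 1 - 1) := by
          rw [Nat.add_sub_cancel]
          cases n with
          | zero =>
            have hPrdeg : Pr.totalDegree = 0 := by
              rw [Pr.eq_C_of_isEmpty, totalDegree_C]
            rw [hPrdeg] at hdeg ⊢
            simpa using hdeg
          | succ m =>
            rw [Nat.add_sub_cancel]
            calc q * (Pr.totalDegree * q ^ m) + q ^ (m + 1) * r
                = (Pr.totalDegree + r) * q ^ (m + 1) := by ring
              _ ≤ p.totalDegree * q ^ (m + 1) := Nat.mul_le_mul_right _ hdeg

end MultSZ

end Literature.NumberTheory.DiophantineGeometry.CafureMateraLemma22
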